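import Summits.ResolutionOfSingularities.ResolutionOfSingularities.Theorems.HilbertSamuelEliminationSigmaMaxModificationsCorridor3SigmaIsoBoundaryDefs
import Summits.ResolutionOfSingularities.ResolutionOfSingularities.Theorems.HilbertSamuelEliminationSigmaMaxModificationsCorridor3SigmaCyclePlusBoundaryPackage
import Summits.ResolutionOfSingularities.ResolutionOfSingularities.Theorems.HilbertSamuelEliminationSigmaMaxModificationsCorridor3WLadderMoving
import HarnessLib

/-!
# [OURS · L1 W4.2] σ-LAYER — `Corridor3SigmaIsoBoundaryRows`: the ISOLATION rows of a BOUNDARY-READING strategy `σ : StrategyE` — Rec = Ev ⊔ Alt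
# on the nose, the covers, Ev-Iso from the strategy-free KERNEL, ALT from the σ-laws, and the POINTED σE-CLOSER BY NAME
# (E-threaded typing convention of res-L1-w42-plan-1 RULING v3.14-12a (BR-10); W4.2 DEAL D16-σ «ISOLATED ROWS ARE STRATEGY-FREE», RULINGS
# v3.14-11a (CP); crux chain w42 `SigmaMaxModificationsCorridor3` stmt-ResolutionOfSingularities-19249 / crux stmt-…-18506;
# `--supports stmt-ResolutionOfSingularities-19249 --as helper`, counted 0)

HONEST FRAMING. OURS proof bookkeeping (pure logic over o1's boundary-threaded σ-vocabulary `…Corridor3SigmaBoundaryDefs` (p523041) and res-type-012's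
`…Corridor3SigmaIsoBoundaryDefs` (E1)); NOTHING here is a statement of H. Hironaka's manuscript [Hironaka2017] nor of Cossart–Jannsen–Saito; theorem-only,
fact-free, no new definition. Every `theorem` is the E-COPY (chains of `MarkedStageE`, grades read on the underlying marked stage, initial boundary `E₀`)
of the BLIND σ-theorem of the same name without `E` in `…Corridor3SigmaIsoRows` (p524281), with the SAME proof term; `reachesσE_chain` is res-type-040's
(`…SigmaCyclePlusBoundaryPackage`). AI-written; AI review is weaker than expert review.

THE σE-CLOSER, for EVERY boundary-reading strategy `σ`, EVERY origin class `Q`, EVERY initial-boundary assignment `E₀`: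

  `WtopRecIsoMσE σ p Q E₀ ⟸ IsoTailTowerExtractionMσE σ p E₀ ∧ IsoQuadraticTowerTerminates p 3 ∧ IsoTransitionLaw3σE σ p Q E₀ ∧ NoRecurrentIsoPointBirth3σE σ p Q E₀`

(`wtopRecIsoMσE_of_kernel`; pointed instance `wtopRecIsoMσE_pointed_of_kernel`). The extraction and the transition law are DISCHARGED for admissible
(functional) σ in `…Corridor3SigmaIsoBoundaryExtraction` / `…Transition`; the birth law is the conjecture-tagged OURS input, as for CJS.

## Contents (namespace `…Theorems.SigmaMaxModificationsCorridor3.Sigma`)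

* §0 monotonicity `noMovingNearChainFromσE_mono`, `noMovingRecurrentNearChainFromσE_mono`.
* §1 splits: `noMovingNearChainFromσE_iff_recurrence`, `noMovingNearChainFromσE_iff_trichotomy`,
  `noMovingRecurrentNearChainFromσE_iff_eventually_alternating`, `noMovingAlternatingNearChainFromσE_of_recurrent(_not)`.
* §2 rows: `wtopRecIsoMσE_of_evIso_alt`, `evIso_alt_of_wtopRecIsoMσE`, `wtopAltMσE_of_wtopRecIsoMσE`, `wtopAltMσE_of_wtopRecNonIsoMσE`, covers
  `atQσE_of_coverA/_of_coverB/_of_trichotomy`, `piecesσE_of_atQ`.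
* §3 `wtopEvIsoMσE_of_towers`. §4 `wtopAltMσE_of_noRecurrentIsoPointBirth3σE`. §5 closers `wtopRecIsoMσE_of_kernel`, `wtopRecIsoMσE_pointed_of_kernel`,
  `atQσE_of_kernel_evNonIso` (the FULL W-top σE-row at `Q` from the four binders and o1's `WtopEvNonIsoMσE σ p Q E₀`).

## References (context only)

* V. Cossart, U. Jannsen, S. Saito, LNM 2270 (2020), Rem. 6.29 (1), Def. 6.38, Thm. 6.35, Thm. 6.40. [CossartJannsenSaito2020]
-/

noncomputable section

set_option linter.dupNamespace false -- mandated namespace of this single-conjunct summit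

open CategoryTheory AlgebraicGeometry TopologicalSpace
open Summit.ResolutionOfSingularities.ResolutionOfSingularities.Theorems.CampaignW42
open Literature.AlgebraicGeometry.Resolution Literature.RingTheory.HilbertSamuel
open Literature.AlgebraicGeometry.CossartJannsenSaito2020
open Summit.ResolutionOfSingularities.ResolutionOfSingularities.Theorems.SigmaMaxModificationsCorridor3.Moving
open Summit.ResolutionOfSingularities.ResolutionOfSingularities.Theorems.SigmaMaxModificationsCorridor3.Helpers (QPointed)
open Summit.ResolutionOfSingularities.ResolutionOfSingularities.Cruxes.SigmaMaxModifications.IdeasL1Idea2R4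

namespace Summit.ResolutionOfSingularities.ResolutionOfSingularities.Theorems.SigmaMaxModificationsCorridor3.Sigma

universe u

variable {σ : StrategyE.{u}} {N : ℕ} {ν : ℕ → ℕ} {E₀ : ∀ (X : Scheme.{u}), X → Boundary X}

/-! ## §0. Chains of σ-steps: reachability along a chain, monotonicity of the functionals -/

/-- Monotonicity of the moving σ-functional in the grade. [folklore] -/
theorem noMovingNearChainFromσE_mono {s₀ : MarkedStageE.{u}} {G G' : MarkedStage.{u} → Prop} (hGG' : ∀ s, G s → G' s)
    (h : NoMovingNearChainFromσE σ N ν s₀ G') : NoMovingNearChainFromσE σ N ν s₀ G :=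
  fun ⟨c, h0, hstep, hG, hmov⟩ => h ⟨c, h0, hstep, fun n => hGG' _ (hG n), hmov⟩

/-- Monotonicity of the moving-recurrent σ-functional in the recurring predicate. [folklore] -/
theorem noMovingRecurrentNearChainFromσE_mono {s₀ : MarkedStageE.{u}} {G B B' : MarkedStage.{u} → Prop}
    (hBB' : ∀ s, B s → B' s) (h : NoMovingRecurrentNearChainFromσE σ N ν s₀ G B') :
    NoMovingRecurrentNearChainFromσE σ N ν s₀ G B :=
  fun ⟨c, h0, hstep, hG, hmov, hio⟩ =>
    h ⟨c, h0, hstep, hG, hmov, fun n => (hio n).imp fun _ hm => ⟨hm.1, hBB' _ hm.2⟩⟩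

/-! ## §1. The recurrence split, the trichotomy, and Rec = Ev ⊔ Alt — for σ-chains -/

/-- **THE SPLIT for moving σ-chains**: no moving `G`-chain ⟺ none eventually outside `B` and none `B`-recurrent (σ-copy of
`noMovingNearChainFrom_iff_recurrence`, same proof). [folklore] -/
theorem noMovingNearChainFromσE_iff_recurrence {s₀ : MarkedStageE.{u}} {G : MarkedStage.{u} → Prop} (B : MarkedStage.{u} → Prop) :
    NoMovingNearChainFromσE σ N ν s₀ G ↔
      (NoMovingNearChainFromσE σ N ν s₀ fun s => G s ∧ ¬ B s) ∧ NoMovingRecurrentNearChainFromσE σ N ν s₀ G B := by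
  constructor
  · intro h
    refine ⟨?_, ?_⟩
    · rintro ⟨c, h0, hstep, hG, hmov⟩
      exact h ⟨c, h0, hstep, fun n => (hG n).1, hmov⟩
    · rintro ⟨c, h0, hstep, hG, hmov, -⟩
      exact h ⟨c, h0, hstep, hG, hmov⟩
  · rintro ⟨htail, hrec⟩ ⟨c, h0, hstep, hG, hmov⟩
    rcases eventually_not_or_io (fun n => B (c n).toMarkedStage) with ⟨n₀, hn₀⟩ | hio
    · exact htail ⟨fun n => c (n₀ + n), reachesσE_chain h0 hstep n₀, fun n => hstep (n₀ + n),
        fun n => ⟨hG _, hn₀ _ (Nat.le_add_right _ _)⟩, io_shift hmov n₀⟩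
    · exact hrec ⟨c, h0, hstep, hG, hmov, hio⟩

/-- **THE TRICHOTOMY SPLIT for moving σ-chains**: no moving `G`-chain from `s₀` ⟺ none eventually inside `B`, none eventually outside `B`,
and none alternating (σ-copy of `noMovingNearChainFrom_iff_trichotomy`, same proof). [folklore] -/
theorem noMovingNearChainFromσE_iff_trichotomy {s₀ : MarkedStageE.{u}} {G : MarkedStage.{u} → Prop} (B : MarkedStage.{u} → Prop) :
    NoMovingNearChainFromσE σ N ν s₀ G ↔
      (NoMovingNearChainFromσE σ N ν s₀ fun s => G s ∧ B s) ∧ (NoMovingNearChainFromσE σ N ν s₀ fun s => G s ∧ ¬ B s) ∧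
        NoMovingAlternatingNearChainFromσE σ N ν s₀ G B := by
  constructor
  · intro h
    refine ⟨?_, ?_, ?_⟩
    · rintro ⟨c, h0, hstep, hG, hmov⟩
      exact h ⟨c, h0, hstep, fun n => (hG n).1, hmov⟩
    · rintro ⟨c, h0, hstep, hG, hmov⟩
      exact h ⟨c, h0, hstep, fun n => (hG n).1, hmov⟩
    · rintro ⟨c, h0, hstep, hG, hmov, -, -⟩
      exact h ⟨c, h0, hstep, hG, hmov⟩
  · rintro ⟨hin, hout, halt⟩ ⟨c, h0, hstep, hG, hmov⟩
    rcases eventually_not_or_io (fun n => B (c n).toMarkedStage) with ⟨n₀, hn₀⟩ | hioB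
    · exact hout ⟨fun n => c (n₀ + n), reachesσE_chain h0 hstep n₀, fun n => hstep (n₀ + n),
        fun n => ⟨hG _, hn₀ _ (Nat.le_add_right _ _)⟩, io_shift hmov n₀⟩
    · rcases eventually_not_or_io (fun n => ¬ B (c n).toMarkedStage) with ⟨n₀, hn₀⟩ | hioN
      · exact hin ⟨fun n => c (n₀ + n), reachesσE_chain h0 hstep n₀, fun n => hstep (n₀ + n),
          fun n => ⟨hG _, Classical.not_not.1 (hn₀ _ (Nat.le_add_right _ _))⟩, io_shift hmov n₀⟩
      · exact halt ⟨c, h0, hstep, hG, hmov, hioB, hioN⟩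

/-- An alternating σ-chain is in particular `B`-recurrent. [folklore] -/
theorem noMovingAlternatingNearChainFromσE_of_recurrent {s₀ : MarkedStageE.{u}} {G B : MarkedStage.{u} → Prop}
    (h : NoMovingRecurrentNearChainFromσE σ N ν s₀ G B) : NoMovingAlternatingNearChainFromσE σ N ν s₀ G B :=
  fun ⟨c, h0, hstep, hG, hmov, hio, _⟩ => h ⟨c, h0, hstep, hG, hmov, hio⟩

/-- … and `¬ B`-recurrent. [folklore] -/
theorem noMovingAlternatingNearChainFromσE_of_recurrent_not {s₀ : MarkedStageE.{u}} {G B : MarkedStage.{u} → Prop}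
    (h : NoMovingRecurrentNearChainFromσE σ N ν s₀ G fun s => ¬ B s) : NoMovingAlternatingNearChainFromσE σ N ν s₀ G B :=
  fun ⟨c, h0, hstep, hG, hmov, _, hio⟩ => h ⟨c, h0, hstep, hG, hmov, hio⟩

/-- **«`B` infinitely often» = «eventually `B`» ⊔ «`B` and `¬ B` both infinitely often»** for moving σ-chains — Rec = Ev ⊔ Alt on the nose
(σ-copy of `noMovingRecurrentNearChainFrom_iff_eventually_alternating`, same proof). [folklore] -/
theorem noMovingRecurrentNearChainFromσE_iff_eventually_alternating {s₀ : MarkedStageE.{u}} {G : MarkedStage.{u} → Prop}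
    (B : MarkedStage.{u} → Prop) :
    NoMovingRecurrentNearChainFromσE σ N ν s₀ G B ↔
      (NoMovingNearChainFromσE σ N ν s₀ fun s => G s ∧ B s) ∧ NoMovingAlternatingNearChainFromσE σ N ν s₀ G B := by
  constructor
  · intro h
    refine ⟨?_, noMovingAlternatingNearChainFromσE_of_recurrent h⟩
    rintro ⟨c, h0, hstep, hG, hmov⟩
    exact h ⟨c, h0, hstep, fun n => (hG n).1, hmov, fun n => ⟨n, le_rfl, (hG n).2⟩⟩
  · rintro ⟨hev, halt⟩ ⟨c, h0, hstep, hG, hmov, hio⟩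
    rcases eventually_not_or_io (fun n => ¬ B (c n).toMarkedStage) with ⟨n₀, hn₀⟩ | hioN
    · exact hev ⟨fun n => c (n₀ + n), reachesσE_chain h0 hstep n₀, fun n => hstep (n₀ + n),
        fun n => ⟨hG _, Classical.not_not.1 (hn₀ _ (Nat.le_add_right _ _))⟩, io_shift hmov n₀⟩
    · exact halt ⟨c, h0, hstep, hG, hmov, hio, hioN⟩

/-! ## §2. Row level at `B = Iso 3`, grade `ē ≥ 3`, for the strategy `σ` -/

/-- **Ev-Iso σ ∧ ALT σ ⇒ Rec-Iso σ**, every origin class `Q`. [folklore] -/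
theorem wtopRecIsoMσE_of_evIso_alt {p : ℕ} {Q : ℕ → (ℕ → ℕ) → ∀ X : Scheme.{u}, X → Prop}
    (hev : WtopEvIsoMσE σ p Q E₀) (halt : WtopAltMσE σ p Q E₀) : WtopRecIsoMσE σ p Q E₀ :=
  fun ν X _ x hX hQ =>
    (noMovingRecurrentNearChainFromσE_iff_eventually_alternating (fun s => Iso 3 s)).2 ⟨hev ν X x hX hQ, halt ν X x hX hQ⟩

/-- … and conversely Rec-Iso σ gives back both legs (exactness). [folklore] -/
theorem evIso_alt_of_wtopRecIsoMσE {p : ℕ} {Q : ℕ → (ℕ → ℕ) → ∀ X : Scheme.{u}, X → Prop} (h : WtopRecIsoMσE σ p Q E₀) :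
    WtopEvIsoMσE σ p Q E₀ ∧ WtopAltMσE σ p Q E₀ :=
  ⟨fun ν X _ x hX hQ => ((noMovingRecurrentNearChainFromσE_iff_eventually_alternating (fun s => Iso 3 s)).1 (h ν X x hX hQ)).1,
    fun ν X _ x hX hQ => noMovingAlternatingNearChainFromσE_of_recurrent (h ν X x hX hQ)⟩

/-- ALT σ is implied by Rec-Iso σ. [folklore] -/
theorem wtopAltMσE_of_wtopRecIsoMσE {p : ℕ} {Q : ℕ → (ℕ → ℕ) → ∀ X : Scheme.{u}, X → Prop} (h : WtopRecIsoMσE σ p Q E₀) :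
    WtopAltMσE σ p Q E₀ :=
  (evIso_alt_of_wtopRecIsoMσE h).2

/-- ALT σ is implied by Rec-NonIso σ. [folklore] -/
theorem wtopAltMσE_of_wtopRecNonIsoMσE {p : ℕ} {Q : ℕ → (ℕ → ℕ) → ∀ X : Scheme.{u}, X → Prop} (h : WtopRecNonIsoMσE σ p Q E₀) :
    WtopAltMσE σ p Q E₀ :=
  fun ν X _ x hX hQ => noMovingAlternatingNearChainFromσE_of_recurrent_not (h ν X x hX hQ)

/-- **Cover A for σ:** Ev-Iso σ ∧ Rec-NonIso σ ⇒ the grade-`≥ 3` moving σ-row at `Q`-origins. [folklore] -/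
theorem atQσE_of_coverA {p : ℕ} {Q : ℕ → (ℕ → ℕ) → ∀ X : Scheme.{u}, X → Prop}
    (hev : WtopEvIsoMσE σ p Q E₀) (hrec : WtopRecNonIsoMσE σ p Q E₀) :
    MaxOriginNoMovingNearChainAtQσE σ p 3 Q E₀ fun s => 3 ≤ s.geomDirDim := by
  intro ν X _ x hX hQ
  refine (noMovingNearChainFromσE_iff_recurrence (fun s => ¬ Iso 3 s)).2 ⟨?_, hrec ν X x hX hQ⟩
  exact noMovingNearChainFromσE_mono (fun s hs => ⟨hs.1, Classical.not_not.1 hs.2⟩) (hev ν X x hX hQ)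

/-- **Cover B for σ:** Rec-Iso σ ∧ Ev-NonIso σ (047's `WtopEvNonIsoMσE`) ⇒ the grade-`≥ 3` moving σ-row at `Q`-origins. [folklore] -/
theorem atQσE_of_coverB {p : ℕ} {Q : ℕ → (ℕ → ℕ) → ∀ X : Scheme.{u}, X → Prop}
    (hrec : WtopRecIsoMσE σ p Q E₀) (hev : WtopEvNonIsoMσE σ p Q E₀) :
    MaxOriginNoMovingNearChainAtQσE σ p 3 Q E₀ fun s => 3 ≤ s.geomDirDim :=
  fun ν X _ x hX hQ => (noMovingNearChainFromσE_iff_recurrence (fun s => Iso 3 s)).2 ⟨hev ν X x hX hQ, hrec ν X x hX hQ⟩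

/-- **Trichotomy cover for σ:** Ev-Iso σ ∧ Ev-NonIso σ ∧ ALT σ ⇒ the grade-`≥ 3` moving σ-row at `Q`-origins. [folklore] -/
theorem atQσE_of_trichotomy {p : ℕ} {Q : ℕ → (ℕ → ℕ) → ∀ X : Scheme.{u}, X → Prop}
    (hev : WtopEvIsoMσE σ p Q E₀) (hnon : WtopEvNonIsoMσE σ p Q E₀) (halt : WtopAltMσE σ p Q E₀) :
    MaxOriginNoMovingNearChainAtQσE σ p 3 Q E₀ fun s => 3 ≤ s.geomDirDim :=
  fun ν X _ x hX hQ =>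
    (noMovingNearChainFromσE_iff_trichotomy (fun s => Iso 3 s)).2 ⟨hev ν X x hX hQ, hnon ν X x hX hQ, halt ν X x hX hQ⟩

/-- **The covers are exact for σ:** the σ-row gives back Ev-Iso, Rec-NonIso, Rec-Iso, Ev-NonIso and ALT. [folklore] -/
theorem piecesσE_of_atQ {p : ℕ} {Q : ℕ → (ℕ → ℕ) → ∀ X : Scheme.{u}, X → Prop}
    (h : MaxOriginNoMovingNearChainAtQσE σ p 3 Q E₀ fun s => 3 ≤ s.geomDirDim) :
    WtopEvIsoMσE σ p Q E₀ ∧ WtopRecNonIsoMσE σ p Q E₀ ∧ WtopRecIsoMσE σ p Q E₀ ∧ WtopEvNonIsoMσE σ p Q E₀ ∧ WtopAltMσE σ p Q E₀ := by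
  refine ⟨fun ν X _ x hX hQ => ?_, fun ν X _ x hX hQ => ?_, fun ν X _ x hX hQ => ?_, fun ν X _ x hX hQ => ?_,
    fun ν X _ x hX hQ => ?_⟩
  · exact noMovingNearChainFromσE_mono (fun s hs => hs.1) (h ν X x hX hQ)
  · exact ((noMovingNearChainFromσE_iff_recurrence (fun s => ¬ Iso 3 s)).1 (h ν X x hX hQ)).2
  · exact ((noMovingNearChainFromσE_iff_recurrence (fun s => Iso 3 s)).1 (h ν X x hX hQ)).2
  · exact ((noMovingNearChainFromσE_iff_recurrence (fun s => Iso 3 s)).1 (h ν X x hX hQ)).1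
  · exact ((noMovingNearChainFromσE_iff_trichotomy (fun s => Iso 3 s)).1 (h ν X x hX hQ)).2.2

/-! ## §3. The eventually-isolated σ-row from the strategy-free kernel and the σ-extraction -/

/-- **Ev-Iso σ FROM THE KERNEL**: the isolated quadratic kernel `IsoQuadraticTowerTerminates p 3` (oracle/strategy/label-free) and the
σ-extraction `IsoTailTowerExtractionMσE σ p` give `WtopEvIsoMσE σ p Q` for EVERY origin class `Q` (σ-copy of r4's `wtopEvIsoM_of_towers`, same
proof). The extraction binder is a THEOREM for admissible functional σ (`Sigma.isoTailTowerExtractionMσ_of_admissible`,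
`…Corridor3SigmaIsoExtraction`). [folklore] -/
theorem wtopEvIsoMσE_of_towers {p : ℕ} (hT : IsoQuadraticTowerTerminates.{u} p 3) (hE : IsoTailTowerExtractionMσE σ p E₀)
    (Q : ℕ → (ℕ → ℕ) → ∀ X : Scheme.{u}, X → Prop) : WtopEvIsoMσE σ p Q E₀ := by
  intro ν X _ x hX _hQ
  rintro ⟨c, h0, hstep, hG, hmov⟩
  obtain ⟨T, pt, hT0, htower⟩ := hE ν X x hX c h0 hstep hG hmov
  exact hT ν T pt hT0 htower

/-! ## §4. ALT for σ from the σ-transition law and the σ-birth law -/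

/-- **ALT σ FROM «NO RECURRENT ISO POINT BIRTHS» (σ-form)** (σ-copy of res-type-067's `wtopAltM_of_noRecurrentIsoPointBirth3`, same proof):
an alternating moving σ-chain has an iso → non-iso transition at consecutive stages beyond every bound (after a late isolated stage `m` take the
FIRST later non-isolated stage); by the σ-transition law that step carries an iso point birth, which the σ-birth law forbids from some stage
on. [folklore] -/
theorem wtopAltMσE_of_noRecurrentIsoPointBirth3σE {p : ℕ} {Q : ℕ → (ℕ → ℕ) → ∀ X : Scheme.{u}, X → Prop}
    (hT : IsoTransitionLaw3σE σ p Q E₀) (hrec : NoRecurrentIsoPointBirth3σE σ p Q E₀) : WtopAltMσE σ p Q E₀ := by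
  classical
  intro ν X _ x hX hQ
  rintro ⟨c, h0, hstep, hG, hmov, hio, hnio⟩
  obtain ⟨n₁, hn₁⟩ := hrec ν X x hX hQ c h0 hstep hG hmov
  obtain ⟨m, hm, hmI⟩ := hio n₁
  obtain ⟨m', hm', hm'N⟩ := hnio m
  have hex : ∃ j, m < j ∧ ¬ Iso 3 (c j).toMarkedStage := by
    refine ⟨m', lt_of_le_of_ne hm' ?_, hm'N⟩
    rintro rfl
    exact hm'N hmI
  obtain ⟨hj₀m, hj₀N⟩ := Nat.find_spec hex
  have hmin : ∀ j, j < Nat.find hex → ¬ (m < j ∧ ¬ Iso 3 (c j).toMarkedStage) := fun j hj => Nat.find_min hex hj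
  obtain ⟨k, hk⟩ : ∃ k, Nat.find hex = k + 1 := Nat.exists_eq_succ_of_ne_zero (by omega)
  have hkI : Iso 3 (c k).toMarkedStage := by
    by_cases hkm : k = m
    · rw [hkm]; exact hmI
    · by_contra hnot
      exact hmin k (by omega) ⟨by omega, hnot⟩
  have hk1 : ¬ Iso 3 (c (k + 1)).toMarkedStage := by
    rw [← hk]; exact hj₀N
  obtain ⟨f, hf, Z', hZ'⟩ := hT ν X x hX hQ c h0 hstep hG k hkI hk1
  exact hn₁ k (by omega) f hf Z' hZ'

/-! ## §5. THE σ-CLOSERS BY NAME -/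

/-- **THE σ-CLOSER (RULINGS v3.14-11a (CP)), every origin class `Q`:** Rec-Iso for the strategy `σ` from the σ-extraction, the strategy-free
isolated KERNEL, the σ-transition law and the σ-birth law — Ev-Iso σ through §3, ALT σ through §4, joined by Rec = Ev ⊔ Alt (§1). For an
admissible functional σ the extraction binder is discharged (`…Corridor3SigmaIsoExtraction`), leaving KERNEL ∧ σ-laws. OURS join. -/
theorem wtopRecIsoMσE_of_kernel {p : ℕ} (Q : ℕ → (ℕ → ℕ) → ∀ X : Scheme.{u}, X → Prop) (hE : IsoTailTowerExtractionMσE σ p E₀)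
    (hT : IsoQuadraticTowerTerminates.{u} p 3) (hlaw : IsoTransitionLaw3σE σ p Q E₀) (hrec : NoRecurrentIsoPointBirth3σE σ p Q E₀) :
    WtopRecIsoMσE σ p Q E₀ :=
  wtopRecIsoMσE_of_evIso_alt (wtopEvIsoMσE_of_towers hT hE Q) (wtopAltMσE_of_noRecurrentIsoPointBirth3σE hlaw hrec)

/-- **THE POINTED σ-CLOSER `wtopRecIsoMσE_pointed_of_kernel` (the name asked by RULINGS v3.14-11a (CP)):** the σ-form of the v8.2 pointed stub's
closer `wtopRecIsoM_pointed_of_kernel_of_birthLaw` (p521299) — `WtopRecIsoMσE σ p QPointed` from the σ-extraction, the KERNEL, the σ-transition law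
at pointed origins and the σ-birth law at pointed origins. OURS join. -/
theorem wtopRecIsoMσE_pointed_of_kernel {p : ℕ} (hE : IsoTailTowerExtractionMσE σ p E₀) (hT : IsoQuadraticTowerTerminates.{u} p 3)
    (hlaw : IsoTransitionLaw3σE σ p QPointed E₀) (hrec : NoRecurrentIsoPointBirth3σE σ p QPointed E₀) : WtopRecIsoMσE σ p QPointed E₀ :=
  wtopRecIsoMσE_of_kernel QPointed hE hT hlaw hrec

/-- **THE FULL W-top σ-ROW AT `Q` (cover B with the kernel):** from the four binders of the σ-closer AND 047's Ev-NonIso σ-row at `Q` — the shape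
the σ-side of `stub_Wtop_elimination` consumes origin by origin (`MaxOriginNoMovingNearChainAtQσE σ p 3 Q (3 ≤ ē)` = no moving W-top σ-chain
at all from a `Q`-maximal origin). OURS join. -/
theorem atQσE_of_kernel_evNonIso {p : ℕ} (Q : ℕ → (ℕ → ℕ) → ∀ X : Scheme.{u}, X → Prop) (hE : IsoTailTowerExtractionMσE σ p E₀)
    (hT : IsoQuadraticTowerTerminates.{u} p 3) (hlaw : IsoTransitionLaw3σE σ p Q E₀) (hrec : NoRecurrentIsoPointBirth3σE σ p Q E₀)
    (hev : WtopEvNonIsoMσE σ p Q E₀) : MaxOriginNoMovingNearChainAtQσE σ p 3 Q E₀ fun s => 3 ≤ s.geomDirDim :=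
  atQσE_of_coverB (wtopRecIsoMσE_of_kernel Q hE hT hlaw hrec) hev

end Summit.ResolutionOfSingularities.ResolutionOfSingularities.Theorems.SigmaMaxModificationsCorridor3.Sigma

end
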